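import Summits.BirchSwinnertonDyer.BirchSwinnertonDyer.Theorems.KolyvaginRoadThreeZhangInduction
import Summits.BirchSwinnertonDyer.BirchSwinnertonDyer.Theorems.KolyvaginRoadThreeZhangRankLowering
import HarnessLib

/-!
# Route `KolyvaginRoadThree`, deciding crux `ZhangSharpFrameAtThreeHL` (item stmt-BirchSwinnertonDyer-19574):
# W. Zhang's induction REFINED — class-side inputs at EVEN levels only (referee g30 R1), rank lowering replaced
# by its printed constituents (R2 ∕ R4 ∕ R6), and the one-frame composition at a prime `p`
# (cell `bsd-stepL`, seat `bsd-stepL-koly3a` g0, ACCEL-LIST (9); `--supports stmt-BirchSwinnertonDyer-19574`, helper)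

HONEST FRAMING. Pure linear algebra plus one bookkeeping step; nothing about elliptic curves or `p = 3` is asserted;
no definition, no named fact, no `sorry`; nothing is booked. The engine `exists_ne_zero_of_zhangInduction(_of_rank_
ne_zero)` (zhang3-p1 p446019 ∕ p446227) takes (A1)–(A5) + (A6⁰). Referee g30's instantiation remarks for the 19574
METHOD skeleton (PRECHECK-ZHANGINDUCTION-g30.md) are made kernel facts here:

* R1 (LEVELS OF ODD PARITY): print defines the classes `κ_m` and the congruence Thm 4.3 at EVEN levels `m ∈ Λ⁺` only,
  while the engine's (A2) quantifies over all levels. `exists_ne_zero_of_zhangInduction_evenLevels` shows the engine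
  only ever CALLS (A2) at even levels: (A2) restricted to `Even n.card` suffices (proof: run the engine with the base
  locus replaced by `Set.univ` at odd levels, where (A2) becomes vacuous). (A3), (A5), (A6⁰) were already even-only;
  (A1) is genuinely used at odd levels (`n ∪ {q₁}`) and stays unrestricted — Prop 5.4 has no parity hypothesis.
* R2 ∕ R4 ∕ R6 (RANK LOWERING DECOMPOSED): `exists_ne_zero_of_lineDichotomy` feeds the engine's (A1) from
  `rankLowering_of_lineDichotomy` (`Theorems/KolyvaginRoadThreeZhangRankLowering.lean`): (L) the finite local line,
  (P1) the kernel description (itself from Poitou–Tate isotropy + transversality, `kernelDescription_of_isotropy`),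
  (P2) Čebotarev, (P3) τ-equivariance with a scalar local sign — for eigen-Selmer spaces `Sel n μ = eig μ ⊓ S n`.
* R5 (REALISATION): `kolyvaginClass_one_ne_zero_of_lineDichotomy_at` is the one-frame composition at a prime `p`
  with the bottom classes realised by genuine Kolyvagin classes `d.kolyvaginClass hp 1` of Kolyvagin-prime support
  (hypothesis `hreal`, as in zhang3's `kolyvaginClass_one_ne_zero_of_zhangInduction_at`) — the conclusion is the
  frame-wise body of `Theses.KolyvaginRoadThree.ZhangSharpFrameAtThreeHL` at `p = 3`. CONDITIONAL on every binder.

For 19574 (registered METHOD skeleton v2r, plan g26 14:43Z; stubs `stub_levelRaisingAtThree` ∕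
`stub_kolyvaginClassesAtThree`): stub A's (A1)-conjunct for the canonical spaces `SelQ` reduces to (L)+(P1)+(P2)+(P3),
stub B's (A2)-conjunct may be supplied at even levels only. PARTITION: O2@3 (B10) × A1 × crux 19574 — none
(composition-engine refinement; types nothing, closes nothing).

References: [cite: WZhang2014, §9 proof of Thm. 9.1 (pp. 240–242), Thm. 4.3, Def. 8.3, Prop. 5.4, Lemma 7.3, Thm. 9.3]
[cite: BertoliniDarmon2005, Lemma 2.6, Thm. 3.2].
-/

namespace Summit.BirchSwinnertonDyer.Rank1Residual.X11b.Three.Koly.ZhangInduction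

open Module

variable {F : Type*} [Field F] {H : Type*} [AddCommGroup H] [Module F H]
  {Q : Type*} [DecidableEq Q] {M : Type*} {L : Q → Type*} [∀ q, AddCommGroup (L q)] [∀ q, Module F (L q)]

/-! ## R1: the class-side input (A2) is needed at EVEN levels only -/

omit [∀ q, AddCommGroup (L q)] [∀ q, Module F (L q)] in
/-- **Zhang's induction with (A2) at even levels only.** Same data and conclusion as
`exists_ne_zero_of_zhangInduction_of_rank_ne_zero`, but the congruence transport (A2) is assumed only at levels `n`
of EVEN cardinality (print: `κ_m`, Thm 4.3 for `m ∈ Λ⁺`; referee g30 R1) — which is all the induction uses, since it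
descends from an even level `n` to the even level `n ∪ {q₁, q₂}`. Proof: apply the engine to the base locus
`B' n := B n` (even `n`) ∕ `Set.univ` (odd `n`), for which (A2) is vacuous at odd levels and (A3) is unchanged.
[cite: WZhang2014, §9 proof of Thm. 9.1, Thm. 4.3 (m ∈ Λ⁺), Def. 8.3] -/
theorem exists_ne_zero_of_zhangInduction_evenLevels
    (Sel : Finset Q → Bool → Submodule F H) (SelRel : Finset Q → Set Q → Bool → Submodule F H)
    (B : Finset Q → Set Q) (κ : M → Finset Q → H) (m₁ : M)
    (hfin : ∀ (n : Finset Q) (S : Set Q) (μ : Bool), FiniteDimensional F (SelRel n S μ))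
    (hA1 : ∀ (n : Finset Q) (μ : Bool) (c : H), c ∈ Sel n μ → c ≠ 0 →
      ∃ q, q ∉ n ∧ c ∉ Sel (insert q n) μ ∧ Sel (insert q n) μ ≤ Sel n μ ∧
        finrank F (Sel (insert q n) μ) + 1 = finrank F (Sel n μ) ∧ Sel (insert q n) (!μ) = Sel n (!μ))
    -- (A2) at EVEN levels only
    (hA2 : ∀ (n : Finset Q), Even n.card → ∀ (q₁ q₂ : Q), q₁ ∉ n → q₂ ∉ insert q₁ n →
      q₂ ∉ B (insert q₂ (insert q₁ n)) → ∃ m, κ m n ≠ 0)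
    (hA3 : ∀ (n : Finset Q), Even n.card → (∃ m, κ m n ≠ 0) →
      ∃ (s : Bool) (d : ℕ), finrank F (Sel n s) = d + 1 ∧ Sel n s = SelRel n (B n) s ∧
        finrank F (SelRel n (B n) (!s)) ≤ d)
    (hA4 : ∀ (n : Finset Q) (q : Q) (S : Set Q) (s : Bool), q ∉ n → q ∈ S → Sel n s ≤ SelRel (insert q n) S s)
    (hA5 : ∀ (n : Finset Q), Even n.card → finrank F (Sel n true) + finrank F (Sel n false) = 1 → κ m₁ n ≠ 0)
    (hA6₀ : ∀ (n : Finset Q), Even n.card → finrank F (Sel n true) + finrank F (Sel n false) ≠ 0) :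
    ∀ (n : Finset Q), Even n.card → ∃ m, κ m n ≠ 0 := by
  classical
  -- the modified base locus
  let B' : Finset Q → Set Q := fun n ↦ if Even n.card then B n else Set.univ
  have hB'even : ∀ n : Finset Q, Even n.card → B' n = B n := fun n hn ↦ if_pos hn
  have hA2' : ∀ (n : Finset Q) (q₁ q₂ : Q), q₁ ∉ n → q₂ ∉ insert q₁ n →
      q₂ ∉ B' (insert q₂ (insert q₁ n)) → ∃ m, κ m n ≠ 0 := by
    intro n q₁ q₂ hq₁ hq₂ hB
    have hcard : (insert q₂ (insert q₁ n)).card = n.card + 2 := by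
      rw [Finset.card_insert_of_notMem hq₂, Finset.card_insert_of_notMem hq₁]
    by_cases hn : Even n.card
    · have heven₂ : Even (insert q₂ (insert q₁ n)).card := by
        obtain ⟨t, ht⟩ := hn
        exact ⟨t + 1, by rw [hcard]; omega⟩
      rw [hB'even _ heven₂] at hB
      exact hA2 n hn q₁ q₂ hq₁ hq₂ hB
    · have hodd₂ : ¬ Even (insert q₂ (insert q₁ n)).card := by
        intro h2
        obtain ⟨t, ht⟩ := h2
        exact hn ⟨t - 1, by omega⟩
      exact absurd (by simp [B', hodd₂]) hB
  have hA3' : ∀ (n : Finset Q), Even n.card → (∃ m, κ m n ≠ 0) →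
      ∃ (s : Bool) (d : ℕ), finrank F (Sel n s) = d + 1 ∧ Sel n s = SelRel n (B' n) s ∧
        finrank F (SelRel n (B' n) (!s)) ≤ d := by
    intro n hn hκ
    rw [hB'even n hn]
    exact hA3 n hn hκ
  exact exists_ne_zero_of_zhangInduction_of_rank_ne_zero Sel SelRel B' κ m₁ hfin hA1 hA2' hA3' hA4 hA5 hA6₀

/-! ## R2 ∕ R4 ∕ R6: the engine on the decomposed rank-lowering inputs -/

/-- **Zhang's induction from the line dichotomy.** Data: sign-free level spaces `S n`, eigenspaces `eig ±` of `τ`,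
`Sel n μ = eig μ ⊓ S n`, localisations `loc q` with finite lines `Lfin q` and signs `ε q` (rank-lowering side);
relaxed spaces `SelRel`, base locus `B`, classes `κ`, bottom index `m₁` (class side). Hypotheses: `2 ≠ 0` in `F`;
finiteness; (L)+(P1)+(P2)+(P3) of `rankLowering_of_lineDichotomy`; (A2) at even levels, (A3), (A4), (A5), (A6⁰).
Conclusion: at every even level some class `κ m n` is non-zero. [cite: WZhang2014, §9 proof of Thm. 9.1,
Prop. 5.4, Lemma 7.3, Thm. 9.2] -/
theorem exists_ne_zero_of_lineDichotomy
    (S : Finset Q → Submodule F H) (eig : Bool → Submodule F H) (Sel : Finset Q → Bool → Submodule F H)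
    (τ : H →ₗ[F] H) (loc : ∀ q : Q, H →ₗ[F] L q) (Lfin : ∀ q : Q, Submodule F (L q)) (ε : Q → Bool)
    (SelRel : Finset Q → Set Q → Bool → Submodule F H) (B : Finset Q → Set Q) (κ : M → Finset Q → H) (m₁ : M)
    (h2 : (2 : F) ≠ 0)
    (hSel : ∀ (n : Finset Q) (μ : Bool), Sel n μ = eig μ ⊓ S n)
    (heig : ∀ (μ : Bool) (x : H), x ∈ eig μ → τ x = if μ then x else -x)
    (hfinS : ∀ n : Finset Q, FiniteDimensional F (S n))
    (hfin : ∀ (n : Finset Q) (S' : Set Q) (μ : Bool), FiniteDimensional F (SelRel n S' μ))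
    -- rank-lowering side: (L), (P1), (P2), (P3)
    (hfinL : ∀ q : Q, FiniteDimensional F (Lfin q))
    (hline : ∀ q : Q, finrank F (Lfin q) ≤ 1)
    (hmem : ∀ (n : Finset Q) (q : Q), q ∉ n → ∀ x ∈ S n, loc q x ∈ Lfin q)
    (hker : ∀ (n : Finset Q) (q : Q), q ∉ n → (∃ c ∈ S n, loc q c ≠ 0) →
      S (insert q n) = S n ⊓ LinearMap.ker (loc q))
    (hcheb : ∀ (n : Finset Q) (μ : Bool) (c : H), c ∈ Sel n μ → c ≠ 0 → ∃ q, q ∉ n ∧ loc q c ≠ 0)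
    (hequiv : ∀ (q : Q) (x : H), loc q (τ x) = if ε q then loc q x else -loc q x)
    -- class side: (A2) at even levels, (A3), (A4), (A5); and (A6⁰)
    (hA2 : ∀ (n : Finset Q), Even n.card → ∀ (q₁ q₂ : Q), q₁ ∉ n → q₂ ∉ insert q₁ n →
      q₂ ∉ B (insert q₂ (insert q₁ n)) → ∃ m, κ m n ≠ 0)
    (hA3 : ∀ (n : Finset Q), Even n.card → (∃ m, κ m n ≠ 0) →
      ∃ (s : Bool) (d : ℕ), finrank F (Sel n s) = d + 1 ∧ Sel n s = SelRel n (B n) s ∧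
        finrank F (SelRel n (B n) (!s)) ≤ d)
    (hA4 : ∀ (n : Finset Q) (q : Q) (S' : Set Q) (s : Bool), q ∉ n → q ∈ S' → Sel n s ≤ SelRel (insert q n) S' s)
    (hA5 : ∀ (n : Finset Q), Even n.card → finrank F (Sel n true) + finrank F (Sel n false) = 1 → κ m₁ n ≠ 0)
    (hA6₀ : ∀ (n : Finset Q), Even n.card → finrank F (Sel n true) + finrank F (Sel n false) ≠ 0) :
    ∀ (n : Finset Q), Even n.card → ∃ m, κ m n ≠ 0 :=
  exists_ne_zero_of_zhangInduction_evenLevels Sel SelRel B κ m₁ hfin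
    (rankLowering_of_lineDichotomy S eig Sel τ loc Lfin ε h2 hSel heig hfinS hfinL hline hmem hker hcheb hequiv)
    hA2 hA3 hA4 hA5 hA6₀

/-! ## R5: the one-frame composition at a prime `p`, bottom classes realised -/

/-- **Sequential composition at ONE frame, any prime `p`, from the decomposed inputs.** At a frame `(W, K, Dt, β,
ι)`, Zhang data over a field `F` with `2 ≠ 0` — eigen-Selmer spaces `Sel n μ = eig μ ⊓ S n`, localisations at
admissible primes with (L)+(P1)+(P2)+(P3), relaxed spaces, a base locus and classes with (A2) (even levels), (A3),
(A4), (A5), (A6⁰) — whose non-zero bottom classes `κ m ∅` are REALISED by genuine Kolyvagin classes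
`d.kolyvaginClass hp 1` of Kolyvagin-prime support on the frame (`hreal`; Zhang Thm 9.3: `κ m ∅ = c(m, 1)`), give a
non-zero mod-`p` Kolyvagin class on that frame — the frame-wise body of `Theses.KolyvaginRoadThree.
ZhangSharpFrameAtThreeHL` at `p = 3`. CONDITIONAL on every binder; nothing is booked.
[cite: WZhang2014, Thm. 9.1, Thm. 9.2, Thm. 9.3] -/
theorem kolyvaginClass_one_ne_zero_of_lineDichotomy_at
    (W : WeierstrassCurve ℚ) [W.IsElliptic] [W.IsGloballyMinimal] [NeZero (W.conductorNorm ℤ)]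
    (K : Type) [Field K] [NumberField K]
    (Dt : Literature.NumberTheory.EllipticCurves.ModularForms.ModularParametrizationData W (W.conductorNorm ℤ))
    (β : ℤ) (ι : K →+* ℂ) {p : ℕ} (hp : p.Prime)
    -- Zhang data at this frame
    (S : Finset Q → Submodule F H) (eig : Bool → Submodule F H) (Sel : Finset Q → Bool → Submodule F H)
    (τ : H →ₗ[F] H) (loc : ∀ q : Q, H →ₗ[F] L q) (Lfin : ∀ q : Q, Submodule F (L q)) (ε : Q → Bool)
    (SelRel : Finset Q → Set Q → Bool → Submodule F H) (B : Finset Q → Set Q) (κ : M → Finset Q → H) (m₁ : M)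
    (h2 : (2 : F) ≠ 0)
    (hSel : ∀ (n : Finset Q) (μ : Bool), Sel n μ = eig μ ⊓ S n)
    (heig : ∀ (μ : Bool) (x : H), x ∈ eig μ → τ x = if μ then x else -x)
    (hfinS : ∀ n : Finset Q, FiniteDimensional F (S n))
    (hfin : ∀ (n : Finset Q) (S' : Set Q) (μ : Bool), FiniteDimensional F (SelRel n S' μ))
    (hfinL : ∀ q : Q, FiniteDimensional F (Lfin q))
    (hline : ∀ q : Q, finrank F (Lfin q) ≤ 1)
    (hmem : ∀ (n : Finset Q) (q : Q), q ∉ n → ∀ x ∈ S n, loc q x ∈ Lfin q)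
    (hker : ∀ (n : Finset Q) (q : Q), q ∉ n → (∃ c ∈ S n, loc q c ≠ 0) →
      S (insert q n) = S n ⊓ LinearMap.ker (loc q))
    (hcheb : ∀ (n : Finset Q) (μ : Bool) (c : H), c ∈ Sel n μ → c ≠ 0 → ∃ q, q ∉ n ∧ loc q c ≠ 0)
    (hequiv : ∀ (q : Q) (x : H), loc q (τ x) = if ε q then loc q x else -loc q x)
    (hA2 : ∀ (n : Finset Q), Even n.card → ∀ (q₁ q₂ : Q), q₁ ∉ n → q₂ ∉ insert q₁ n →
      q₂ ∉ B (insert q₂ (insert q₁ n)) → ∃ m, κ m n ≠ 0)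
    (hA3 : ∀ (n : Finset Q), Even n.card → (∃ m, κ m n ≠ 0) →
      ∃ (s : Bool) (d : ℕ), finrank F (Sel n s) = d + 1 ∧ Sel n s = SelRel n (B n) s ∧
        finrank F (SelRel n (B n) (!s)) ≤ d)
    (hA4 : ∀ (n : Finset Q) (q : Q) (S' : Set Q) (s : Bool), q ∉ n → q ∈ S' → Sel n s ≤ SelRel (insert q n) S' s)
    (hA5 : ∀ (n : Finset Q), Even n.card → finrank F (Sel n true) + finrank F (Sel n false) = 1 → κ m₁ n ≠ 0)
    (hA6₀ : ∀ (n : Finset Q), Even n.card → finrank F (Sel n true) + finrank F (Sel n false) ≠ 0)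
    -- realisation of the bottom classes as the frame's Kolyvagin classes mod p
    (hreal : ∀ m, κ m ∅ ≠ 0 →
      ∃ (n : ℕ) (d : Literature.NumberTheory.EllipticCurves.KolyvaginHeegnerData Dt β ι n),
        Literature.NumberTheory.EllipticCurves.KolyvaginDescent.KolSupp
            (Literature.NumberTheory.EllipticCurves.Zhang2014.IsKolyvaginPrime (W.conductorNorm ℤ) W K p) n ∧
          d.kolyvaginClass hp 1 ≠ 0) :
    ∃ (n : ℕ) (d : Literature.NumberTheory.EllipticCurves.KolyvaginHeegnerData Dt β ι n),
      Literature.NumberTheory.EllipticCurves.KolyvaginDescent.KolSupp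
          (Literature.NumberTheory.EllipticCurves.Zhang2014.IsKolyvaginPrime (W.conductorNorm ℤ) W K p) n ∧
        d.kolyvaginClass hp 1 ≠ 0 := by
  obtain ⟨m, hm⟩ := exists_ne_zero_of_lineDichotomy S eig Sel τ loc Lfin ε SelRel B κ m₁ h2 hSel heig hfinS hfin
    hfinL hline hmem hker hcheb hequiv hA2 hA3 hA4 hA5 hA6₀ ∅ (by simp)
  exact hreal m hm

end Summit.BirchSwinnertonDyer.Rank1Residual.X11b.Three.Koly.ZhangInduction
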